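import Summits.RiemannHypothesis.RiemannHypothesis.Theorems.JensenPolynomialsFarGumbelCurvature
import Mathlib.Analysis.Calculus.MeanValue
import Mathlib.Analysis.SpecialFunctions.Complex.LogDeriv

/-!
# Route `JensenPolynomials`, FAR crux `XiWindowZeroFreeRelFar` (B1-rel far) — S3 WANTED item (L5), part 1: the Gumbel phase
`f(ξ; w, ε)` is `ε`-Lipschitz on the saddle disc (RH-FREE; cell rh-jensen, HUMAN RULING D-0040)

Item `stmt-RiemannHypothesis-19465`, stub S3 `stub_laplaceFar`, eng-4 g3's WANTED list v3 (HOME `eng-4/S3/S3-WANTED.lean`), item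
(L5) `wanted_value` compares `Re Ψ(u)` on the saddle disc `‖u − (υ + ξ₀/4)‖ ≤ 1/(10υ²)` with `farMain`, whose `Λ`-part is
`Λ·Re f(ξ₀; w, ε)` (`f = farF w ε`, `w = farW z̃`, `ε = 1/υ`, `ξ₀ = farXi0 w ε = Log w·(1 + ε(1/4 − w/2))`). In the variable
`ξ = 4(u − υ)` the disc is `‖ξ − ξ₀‖ ≤ (2/5)ε²`, and this file shows

  `‖f(ξ) − f(ξ₀)‖ ≤ ε·‖ξ − ξ₀‖ ≤ (2/5)ε³`     (`norm_farF_sub_le`),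

from the derivative `f′(ζ) = w(1 + εζ/4)/(1 + wq(ζ)) − e^ζ` (`hasDerivAt_farF`, `q(ζ) = εζ/2 + ε²ζ²/16`) and the first-order
cancellation at `Log w`: writing `ζ = Log w + θ + η` (`θ = ε Log w(1/4 − w/2)`, `‖η‖ ≤ (2/5)ε²`) one has `e^ζ = w e^{θ+η}` and
`f′(ζ) = w[(εζ(1/4 − w/2) − wε²ζ²/16)/(1 + wq) − (e^{θ+η} − 1)]`, each bracket term being `≤ 0.31ε` in norm
(`‖Log w‖ ≤ 37/80` and `Re w ≥ 25/34`, `‖w‖ ≤ 25/16` from eng-4 g3's `JensenPolynomialsFarGumbelCurvature`; `‖1/4 − w/2‖ ≤ 17/32`).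
WHAT THIS IS NOT: calculus of an explicit elementary function; nothing here bears on the zeros of `ζ` or the truth of RH.
Landed `--supports stmt-RiemannHypothesis-19465 --as helper` by prover-rh-jensen-prover-g5-0.
-/

noncomputable section
-- D-0017: `Summit.RiemannHypothesis.RiemannHypothesis.…` duplicates the namespace BY DESIGN (single-problem summit).
set_option linter.dupNamespace false

namespace Summit.RiemannHypothesis.RiemannHypothesis.Theorems.JensenPolynomials.FarGumbel

open Complex Metric Set
open scoped Real

/-! ## 1. Geometry of `w = (1+z̃)⁻¹` -/

/-- `‖1/4 − w/2‖ ≤ 17/32` for `w = farW z̃`, `‖z̃‖ ≤ 9/25` (`1/4 − w/2 = (z̃ − 1)/(4(1+z̃))`). -/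
theorem norm_quarter_sub_half_farW_le {z : ℂ} (hz : ‖z‖ ≤ 9 / 25) : ‖(1 / 4 : ℂ) - farW z / 2‖ ≤ 17 / 32 := by
  have h1 : 16 / 25 ≤ ‖1 + z‖ := by
    have h3 := norm_add_le (1 + z) (-z)
    simp only [add_neg_cancel_right, norm_neg] at h3
    have : ‖(1 : ℂ)‖ = 1 := by simp
    linarith
  have h1z : (1 + z) ≠ 0 := by
    intro h; rw [h, norm_zero] at h1; linarith
  have e : (1 / 4 : ℂ) - farW z / 2 = (z - 1) / (4 * (1 + z)) := by
    rw [farW]; field_simp; ring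
  rw [e, norm_div, norm_mul]
  have e4 : ‖(4 : ℂ)‖ = 4 := by simp
  rw [e4, div_le_iff₀ (by positivity)]
  calc ‖z - 1‖ ≤ ‖z‖ + ‖(1 : ℂ)‖ := norm_sub_le _ _
    _ ≤ 9 / 25 + 1 := by rw [norm_one]; linarith
    _ ≤ 17 / 32 * (4 * ‖1 + z‖) := by linarith

/-! ## 2. The derivative of the Gumbel phase -/

/-- **`f′(ξ) = w(1 + εξ/4)/(1 + wq(ξ)) − e^ξ`** (`q(ξ) = εξ/2 + ε²ξ²/16`), wherever `1 + wq(ξ)` is in the slit plane. -/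
theorem hasDerivAt_farF (w : ℂ) {ε : ℝ} (hε : ε ≠ 0) {ξ : ℂ}
    (hs : 1 + w * ((ε : ℂ) * ξ / 2 + (ε : ℂ) ^ 2 * ξ ^ 2 / 16) ∈ slitPlane) :
    HasDerivAt (farF w ε)
      (w * (1 + (ε : ℂ) * ξ / 4) / (1 + w * ((ε : ℂ) * ξ / 2 + (ε : ℂ) ^ 2 * ξ ^ 2 / 16)) - Complex.exp ξ) ξ := by
  have hq : HasDerivAt (fun ξ : ℂ => 1 + w * ((ε : ℂ) * ξ / 2 + (ε : ℂ) ^ 2 * ξ ^ 2 / 16))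
      (w * ((ε : ℂ) / 2 + (ε : ℂ) ^ 2 * (2 * ξ) / 16)) ξ := by
    have h1 : HasDerivAt (fun ξ : ℂ => (ε : ℂ) * ξ / 2) ((ε : ℂ) / 2) ξ := by
      simpa using ((hasDerivAt_id ξ).const_mul (ε : ℂ)).div_const 2
    have h2 : HasDerivAt (fun ξ : ℂ => (ε : ℂ) ^ 2 * ξ ^ 2 / 16) ((ε : ℂ) ^ 2 * (2 * ξ) / 16) ξ := by
      have := ((hasDerivAt_pow 2 ξ).const_mul ((ε : ℂ) ^ 2)).div_const 16
      simpa using this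
    exact ((h1.add h2).const_mul w).const_add 1
  have hne : 1 + w * ((ε : ℂ) * ξ / 2 + (ε : ℂ) ^ 2 * ξ ^ 2 / 16) ≠ 0 := fun h => Complex.zero_notMem_slitPlane (h ▸ hs)
  have hlog := hq.clog hs
  have h : HasDerivAt
      (fun x : ℂ => (((2 / ε : ℝ)) : ℂ) * Complex.log (1 + w * ((ε : ℂ) * x / 2 + (ε : ℂ) ^ 2 * x ^ 2 / 16)) -
        Complex.exp x)
      ((((2 / ε : ℝ)) : ℂ) * (w * ((ε : ℂ) / 2 + (ε : ℂ) ^ 2 * (2 * ξ) / 16) /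
          (1 + w * ((ε : ℂ) * ξ / 2 + (ε : ℂ) ^ 2 * ξ ^ 2 / 16))) - Complex.exp ξ) ξ :=
    (hlog.const_mul _).sub (Complex.hasDerivAt_exp ξ)
  have hε' : (ε : ℂ) ≠ 0 := by exact_mod_cast hε
  have e : (((2 / ε : ℝ)) : ℂ) * (w * ((ε : ℂ) / 2 + (ε : ℂ) ^ 2 * (2 * ξ) / 16) /
        (1 + w * ((ε : ℂ) * ξ / 2 + (ε : ℂ) ^ 2 * ξ ^ 2 / 16))) - Complex.exp ξ =
      w * (1 + (ε : ℂ) * ξ / 4) / (1 + w * ((ε : ℂ) * ξ / 2 + (ε : ℂ) ^ 2 * ξ ^ 2 / 16)) - Complex.exp ξ := by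
    congr 1
    push_cast
    field_simp
    ring
  exact h.congr_deriv e

/-! ## 3. The Lipschitz bound on the saddle disc -/

/-- On the disc `‖ζ − ξ₀‖ ≤ (2/5)ε²` (`ξ₀ = farXi0 w ε`, `w = farW z̃`, `‖z̃‖ ≤ 9/25`, `0 < ε ≤ 20/189`): `1 + wq(ζ)` lies in the
slit plane and `‖f′(ζ)‖ ≤ ε`. -/
theorem norm_deriv_farF_le {z : ℂ} (hz : ‖z‖ ≤ 9 / 25) {ε : ℝ} (hε : 0 < ε) (hε' : ε ≤ 20 / 189) {ζ : ℂ}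
    (hζ : ‖ζ - farXi0 (farW z) ε‖ ≤ 2 / 5 * ε ^ 2) :
    1 + farW z * ((ε : ℂ) * ζ / 2 + (ε : ℂ) ^ 2 * ζ ^ 2 / 16) ∈ slitPlane ∧
      ‖farW z * (1 + (ε : ℂ) * ζ / 4) / (1 + farW z * ((ε : ℂ) * ζ / 2 + (ε : ℂ) ^ 2 * ζ ^ 2 / 16)) -
          Complex.exp ζ‖ ≤ ε := by
  set w := farW z with hwdef
  have hw' : w = (1 + z)⁻¹ := rfl
  have hwre : 25 / 34 ≤ w.re := by
    have := re_inv_one_add_ge hz (by norm_num : (9 / 25 : ℝ) < 1)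
    rw [hw']
    norm_num at this ⊢
    exact this
  have hwn : ‖w‖ ≤ 25 / 16 := by
    have := norm_inv_one_add_le hz (by norm_num : (9 / 25 : ℝ) < 1)
    rw [hw']
    norm_num at this ⊢
    exact this
  have hw0 : w ≠ 0 := by
    intro h
    rw [h] at hwre
    simp at hwre
    linarith
  set L := Complex.log w with hLdef
  have hL : ‖L‖ ≤ 37 / 80 := norm_log_farW_le hz
  have hκ : ‖(1 / 4 : ℂ) - w / 2‖ ≤ 17 / 32 := norm_quarter_sub_half_farW_le hz
  set θ : ℂ := L * ((ε : ℂ) * (1 / 4 - w / 2)) with hθdef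
  have hξ0 : farXi0 w ε = L + θ := by rw [farXi0, hθdef, hLdef]; ring
  have hεn : ‖(ε : ℂ)‖ = ε := by rw [Complex.norm_real, Real.norm_eq_abs, abs_of_pos hε]
  have hθ : ‖θ‖ ≤ 1 / 4 * ε := by
    rw [hθdef, norm_mul, norm_mul, hεn]
    calc ‖L‖ * (ε * ‖(1 / 4 : ℂ) - w / 2‖) ≤ 37 / 80 * (ε * (17 / 32)) := by gcongr
      _ ≤ 1 / 4 * ε := by linarith
  -- `η = ζ − ξ₀`, `s = θ + η`, `ζ = L + s`
  set η : ℂ := ζ - farXi0 w ε with hηdef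
  have hε2 : ε ^ 2 ≤ 20 / 189 * ε := by nlinarith
  have hη : ‖η‖ ≤ 9 / 200 * ε := by
    have : ‖η‖ ≤ 2 / 5 * ε ^ 2 := hζ
    linarith
  set s : ℂ := θ + η with hsdef
  have hζeq : ζ = L + s := by rw [hsdef, hηdef, hξ0]; ring
  have hs : ‖s‖ ≤ 59 / 200 * ε := by
    calc ‖s‖ ≤ ‖θ‖ + ‖η‖ := norm_add_le _ _
      _ ≤ 1 / 4 * ε + 9 / 200 * ε := add_le_add hθ hη
      _ = 59 / 200 * ε := by ring
  have hs1 : ‖s‖ ≤ 1 / 32 := by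
    calc ‖s‖ ≤ 59 / 200 * ε := hs
      _ ≤ 59 / 200 * (20 / 189) := by gcongr
      _ ≤ 1 / 32 := by norm_num
  have hζn : ‖ζ‖ ≤ 79 / 160 := by
    rw [hζeq]
    calc ‖L + s‖ ≤ ‖L‖ + ‖s‖ := norm_add_le _ _
      _ ≤ 37 / 80 + 1 / 32 := add_le_add hL hs1
      _ = 79 / 160 := by norm_num
  -- `q(ζ)` and `wq`
  set q : ℂ := (ε : ℂ) * ζ / 2 + (ε : ℂ) ^ 2 * ζ ^ 2 / 16 with hqdef
  have e2 : ‖(2 : ℂ)‖ = 2 := by simp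
  have e16 : ‖(16 : ℂ)‖ = 16 := by simp
  have hq : ‖q‖ ≤ ε * (79 / 160) / 2 + ε ^ 2 * (79 / 160) ^ 2 / 16 := by
    rw [hqdef]
    calc ‖(ε : ℂ) * ζ / 2 + (ε : ℂ) ^ 2 * ζ ^ 2 / 16‖ ≤ ‖(ε : ℂ) * ζ / 2‖ + ‖(ε : ℂ) ^ 2 * ζ ^ 2 / 16‖ :=
          norm_add_le _ _
      _ = ε * ‖ζ‖ / 2 + ε ^ 2 * ‖ζ‖ ^ 2 / 16 := by
          rw [norm_div, norm_div, norm_mul, norm_mul, norm_pow, norm_pow, hεn, e2, e16]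
      _ ≤ ε * (79 / 160) / 2 + ε ^ 2 * (79 / 160) ^ 2 / 16 := by gcongr
  have hwq : ‖w * q‖ ≤ 1 / 24 := by
    rw [norm_mul]
    calc ‖w‖ * ‖q‖ ≤ 25 / 16 * (ε * (79 / 160) / 2 + ε ^ 2 * (79 / 160) ^ 2 / 16) := by gcongr
      _ ≤ 25 / 16 * (20 / 189 * (79 / 160) / 2 + (20 / 189) ^ 2 * (79 / 160) ^ 2 / 16) := by gcongr
      _ ≤ 1 / 24 := by norm_num
  have hslit : 1 + w * q ∈ slitPlane := by
    rw [Complex.mem_slitPlane_iff]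
    left
    have := (abs_le.mp ((Complex.abs_re_le_norm (w * q)).trans hwq)).1
    simp only [Complex.add_re, Complex.one_re]
    linarith
  have hne : 1 + w * q ≠ 0 := fun h => Complex.zero_notMem_slitPlane (h ▸ hslit)
  have hinv : ‖(1 + w * q)⁻¹‖ ≤ 24 / 23 := by
    have h1 : 23 / 24 ≤ ‖1 + w * q‖ := by
      have h3 := norm_add_le (1 + w * q) (-(w * q))
      simp only [add_neg_cancel_right, norm_neg] at h3
      have : ‖(1 : ℂ)‖ = 1 := by simp
      linarith
    rw [norm_inv, inv_eq_one_div]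
    calc 1 / ‖1 + w * q‖ ≤ 1 / (23 / 24) := one_div_le_one_div_of_le (by norm_num) h1
      _ = 24 / 23 := by norm_num
  refine ⟨hslit, ?_⟩
  -- the derivative: `f′(ζ) = w·[(εζ(1/4 − w/2) − wε²ζ²/16)/(1 + wq) − (e^{s} − 1)]`, using `e^ζ = w·e^{s}`
  have hexpζ : Complex.exp ζ = w * Complex.exp s := by
    rw [hζeq, Complex.exp_add, hLdef, Complex.exp_log hw0]
  have hf : w * (1 + (ε : ℂ) * ζ / 4) / (1 + w * q) - Complex.exp ζ =
      w * ((((ε : ℂ) * ζ * (1 / 4 - w / 2) - w * ((ε : ℂ) ^ 2 * ζ ^ 2 / 16)) / (1 + w * q)) -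
        (Complex.exp s - 1)) := by
    rw [hexpζ]
    field_simp
    rw [hqdef]
    ring
  rw [hf, norm_mul]
  have hA : ‖(ε : ℂ) * ζ * (1 / 4 - w / 2) - w * ((ε : ℂ) ^ 2 * ζ ^ 2 / 16)‖ ≤
      ε * (79 / 160) * (17 / 32) + 25 / 16 * (ε ^ 2 * (79 / 160) ^ 2 / 16) := by
    calc _ ≤ ‖(ε : ℂ) * ζ * (1 / 4 - w / 2)‖ + ‖w * ((ε : ℂ) ^ 2 * ζ ^ 2 / 16)‖ := norm_sub_le _ _
      _ = ε * ‖ζ‖ * ‖(1 / 4 : ℂ) - w / 2‖ + ‖w‖ * (ε ^ 2 * ‖ζ‖ ^ 2 / 16) := by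
          rw [norm_mul, norm_mul, hεn, norm_mul, norm_div, norm_mul, norm_pow, norm_pow, hεn, e16]
      _ ≤ ε * (79 / 160) * (17 / 32) + 25 / 16 * (ε ^ 2 * (79 / 160) ^ 2 / 16) := by gcongr
  have hB : ‖Complex.exp s - 1‖ ≤ 59 / 200 * ε * (33 / 32) := by
    have h1 := Complex.norm_exp_sub_one_sub_id_le (x := s) (by linarith [hs1])
    have e : Complex.exp s - 1 = (Complex.exp s - 1 - s) + s := by ring
    rw [e]
    calc ‖(Complex.exp s - 1 - s) + s‖ ≤ ‖Complex.exp s - 1 - s‖ + ‖s‖ := norm_add_le _ _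
      _ ≤ ‖s‖ ^ 2 + ‖s‖ := by gcongr
      _ = ‖s‖ * (‖s‖ + 1) := by ring
      _ ≤ (59 / 200 * ε) * (1 / 32 + 1) := by
          apply mul_le_mul hs (by linarith) (by positivity) (by positivity)
      _ = 59 / 200 * ε * (33 / 32) := by norm_num
  have hfrac : ‖((ε : ℂ) * ζ * (1 / 4 - w / 2) - w * ((ε : ℂ) ^ 2 * ζ ^ 2 / 16)) / (1 + w * q)‖ ≤
      (ε * (79 / 160) * (17 / 32) + 25 / 16 * (ε ^ 2 * (79 / 160) ^ 2 / 16)) * (24 / 23) := by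
    rw [div_eq_mul_inv, norm_mul]
    exact mul_le_mul hA hinv (norm_nonneg _) (by positivity)
  calc ‖w‖ * ‖((ε : ℂ) * ζ * (1 / 4 - w / 2) - w * ((ε : ℂ) ^ 2 * ζ ^ 2 / 16)) / (1 + w * q) -
          (Complex.exp s - 1)‖
      ≤ 25 / 16 * ((ε * (79 / 160) * (17 / 32) + 25 / 16 * (ε ^ 2 * (79 / 160) ^ 2 / 16)) * (24 / 23) +
          59 / 200 * ε * (33 / 32)) := by
        apply mul_le_mul hwn _ (norm_nonneg _) (by norm_num)
        exact (norm_sub_le _ _).trans (add_le_add hfrac hB)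
    _ ≤ ε := by linarith [hε2, hε]

/-- **The Gumbel phase is `ε`-Lipschitz on the saddle disc**: for `‖z̃‖ ≤ 9/25`, `0 < ε ≤ 20/189` and
`‖ξ − ξ₀‖ ≤ (2/5)ε²` (`ξ₀ = farXi0 w ε`, `w = farW z̃`): `‖f(ξ; w, ε) − f(ξ₀; w, ε)‖ ≤ ε·‖ξ − ξ₀‖`. -/
theorem norm_farF_sub_le {z : ℂ} (hz : ‖z‖ ≤ 9 / 25) {ε : ℝ} (hε : 0 < ε) (hε' : ε ≤ 20 / 189) {ξ : ℂ}
    (hξ : ‖ξ - farXi0 (farW z) ε‖ ≤ 2 / 5 * ε ^ 2) :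
    ‖farF (farW z) ε ξ - farF (farW z) ε (farXi0 (farW z) ε)‖ ≤ ε * ‖ξ - farXi0 (farW z) ε‖ := by
  set ξ₀ := farXi0 (farW z) ε with hξ0
  have hconv : Convex ℝ (closedBall ξ₀ (2 / 5 * ε ^ 2)) := convex_closedBall _ _
  have hmem : ∀ ζ ∈ closedBall ξ₀ (2 / 5 * ε ^ 2), ‖ζ - farXi0 (farW z) ε‖ ≤ 2 / 5 * ε ^ 2 := by
    intro ζ hζ
    rw [mem_closedBall, dist_eq_norm] at hζ
    exact hζ
  have h := hconv.norm_image_sub_le_of_norm_hasDerivWithin_le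
    (f := farF (farW z) ε)
    (f' := fun ζ => farW z * (1 + (ε : ℂ) * ζ / 4) /
      (1 + farW z * ((ε : ℂ) * ζ / 2 + (ε : ℂ) ^ 2 * ζ ^ 2 / 16)) - Complex.exp ζ)
    (fun ζ hζ => (hasDerivAt_farF (farW z) hε.ne' (norm_deriv_farF_le hz hε hε' (hmem ζ hζ)).1).hasDerivWithinAt)
    (fun ζ hζ => (norm_deriv_farF_le hz hε hε' (hmem ζ hζ)).2)
    (mem_closedBall_self (by positivity))
    (by rw [mem_closedBall, dist_eq_norm]; exact hξ)
  exact h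

end Summit.RiemannHypothesis.RiemannHypothesis.Theorems.JensenPolynomials.FarGumbel

end
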